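import Literature.Analysis.FluidPDE.LerayPressureDecayProofs
import Literature.Analysis.Potential.NewtonFarField
import HarnessLib

/-!
# Seregin's Lemma B.6: the far-field pressure with the cut-off (B.2.17)–(B.2.20)

Analysis/FluidPDE proof file (theorems only) on the discharge path of
`Literature.Analysis.FluidPDE.seregin2014_limit_decay` (Seregin 2014, App. B, Lemma B.6). In
the proof of Lemma B.6 (PDF p. 155) the far part `p²_{x₀}` of the local pressure expansion,
split at the radius `ρ = √R` into the shell part `p_{x₀,ρ}` and the tail `p̄_{x₀,ρ}`, is
estimated pointwise on `B(x₀, 3/2)` after multiplication by the cut-off `χ_R`: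
`χ_R p_{x₀,ρ} = q₃ + q₄` with "`|q₃(x,t)| ≤ c (ρ/R) α(t)`" (B.2.17) (the factor
`χ_R(x) − χ_R(y)`, `|∇χ_R| ≤ c/R`, `|x − y| ≤ cρ`), "`|q₄(x,t)| ≤ c α_R^{1/2}(t) α^{1/2}(t)`"
(B.2.18) (the factor `χ_R(y)` kept inside, Cauchy–Schwarz), and "`J₃ ≤ c ρ⁻¹ α(t)`" (B.2.20)
for the tail (Lemma B.5 / (B.2.2)). Here this is proved for the tree's far-field pressure
`localPressureFar x₀ 2 v t` (expansion radius `2`, near ball `B(x₀,4)`) and the tree's cut-off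
`χ_R = 1 − cutoff R`, slice by slice, with the unit-ball energies `α ≥ sup_z ∫_{B(z,1)}|v(t)|²`
and `α_R ≥ sup_z ∫_{B(z,1)} χ_R²|v(t)|²` as data:

* `one_sub_cutoff_mul_enorm_localPressureFar_le` —
  `χ_R(x) |p_far(t,x)| ≤ K (ρ⁻¹ α + (ρ/R) α + α_R^{1/2} α^{1/2})` for `x ∈ B(x₀,3/2)`, `ρ ≥ 2`,
  `R ≥ 1`, with `K` absolute (two-centre kernel bound `exists_abs_pressureKernel_sub_le`, the
  uniformly local tail `lintegral_compl_ball_mul_powKer_le`, `∫_{|z|≥r}|z|⁻⁴ = c₄/r`).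

## References

* G. Seregin, *Lecture Notes on Regularity Theory for the Navier–Stokes Equations* (2014),
  doi:10.1142/9314, App. B, Lemma B.5 (B.2.2) and proof of Lemma B.6, (B.2.17)–(B.2.20),
  PDF p. 155. Bib key `Seregin2014`.
* K. Kang, H. Miura, T.-P. Tsai, arXiv:1812.10509, §8 (far-field bound). Bib key
  `KangMiuraTsai2020`.
-/

noncomputable section

open MeasureTheory TopologicalSpace Set Function Filter Metric
open _root_.Topology
open scoped ENNReal NNReal RealInnerProductSpace

namespace Literature.Analysis.FluidPDE

/-! ### The cut-off is Lipschitz with constant `C/R` -/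

/-- `|χ_R(x) − χ_R(y)| ≤ (C/R) |x − y|` for the cut-off `χ_R = 1 − cutoff R` (mean value
inequality with `‖D(cutoff R)‖ ≤ C/R`). [folklore] -/
theorem exists_abs_one_sub_cutoff_sub_le :
    ∃ C : ℝ, 0 ≤ C ∧ ∀ R : ℝ, 0 < R → ∀ x y : EuclideanSpace ℝ (Fin 3),
      |(1 - cutoff R x) - (1 - cutoff R y)| ≤ C / R * ‖x - y‖ := by
  obtain ⟨C, hC0, hC⟩ := exists_norm_fderiv_cutoff_le (E := EuclideanSpace ℝ (Fin 3))
  refine ⟨C, hC0, fun R hR x y => ?_⟩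
  have hdiff : ∀ z ∈ (univ : Set (EuclideanSpace ℝ (Fin 3))),
      DifferentiableAt ℝ (cutoff (E := EuclideanSpace ℝ (Fin 3)) R) z := fun z _ =>
    ((contDiff_cutoff (n := 1) R).differentiable one_ne_zero) z
  have h := convex_univ.norm_image_sub_le_of_norm_fderiv_le hdiff (fun z _ => hC R hR z)
    (mem_univ y) (mem_univ x)
  rw [Real.norm_eq_abs] at h
  calc |(1 - cutoff R x) - (1 - cutoff R y)| = |cutoff R x - cutoff R y| := by
        rw [show (1 - cutoff R x) - (1 - cutoff R y) = -(cutoff R x - cutoff R y) by ring, abs_neg]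
    _ ≤ C / R * ‖x - y‖ := h

/-! ### Pointwise kernel-difference bound in the `powKer` form -/

/-- For `x ∈ B(x₀, 3/2)` and `‖y − x₀‖ ≥ 3`, the two-centre bound in the form
`‖K(x−y)(a) − K(x₀−y)(a)‖ₑ ≤ (3K/2) ‖a‖ₑ² |y − x₀|⁻⁴`. [folklore] -/
theorem enorm_pressureKernel_sub_le_powKer {K : ℝ} (hK0 : 0 ≤ K)
    (hK : ∀ x₀ x y a : EuclideanSpace ℝ (Fin 3), 2 * ‖x - x₀‖ ≤ ‖y - x₀‖ → y ≠ x₀ →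
      |pressureKernel (x - y) a - pressureKernel (x₀ - y) a| ≤
        K * ‖x - x₀‖ * ‖a‖ ^ 2 / ‖y - x₀‖ ^ 4)
    {x₀ x y : EuclideanSpace ℝ (Fin 3)} (hx : ‖x - x₀‖ < 3 / 2) (hy : 3 ≤ ‖y - x₀‖)
    (a : EuclideanSpace ℝ (Fin 3)) :
    ‖pressureKernel (x - y) a - pressureKernel (x₀ - y) a‖ₑ ≤
      ENNReal.ofReal (3 / 2 * K) * (‖a‖ₑ ^ (2 : ℕ) * RieszKernel.powKer 4 (y - x₀)) := by
  have hypos : 0 < ‖y - x₀‖ := by linarith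
  have hy0 : y ≠ x₀ := fun h => by
    rw [h, sub_self, norm_zero] at hypos
    exact lt_irrefl _ hypos
  have h2 : 2 * ‖x - x₀‖ ≤ ‖y - x₀‖ := by linarith
  have hb := hK x₀ x y a h2 hy0
  rw [Real.enorm_eq_ofReal_abs, RieszKernel.powKer_apply, ← ofReal_norm,
    ← ENNReal.ofReal_pow (norm_nonneg _), ← ENNReal.ofReal_mul (by positivity),
    ← ENNReal.ofReal_mul (by positivity)]
  refine ENNReal.ofReal_le_ofReal (hb.trans ?_)
  have e4 : ‖y - x₀‖ ^ (-4 : ℝ) = (‖y - x₀‖ ^ 4)⁻¹ := by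
    rw [Real.rpow_neg hypos.le, show (4 : ℝ) = ((4 : ℕ) : ℝ) by norm_num, Real.rpow_natCast]
  rw [e4]
  have hi : 0 ≤ ‖a‖ ^ 2 * (‖y - x₀‖ ^ 4)⁻¹ := by positivity
  calc K * ‖x - x₀‖ * ‖a‖ ^ 2 / ‖y - x₀‖ ^ 4
      = K * ‖x - x₀‖ * (‖a‖ ^ 2 * (‖y - x₀‖ ^ 4)⁻¹) := by ring
    _ ≤ K * (3 / 2) * (‖a‖ ^ 2 * (‖y - x₀‖ ^ 4)⁻¹) := by
        refine mul_le_mul_of_nonneg_right ?_ hi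
        exact mul_le_mul_of_nonneg_left hx.le hK0
    _ = 3 / 2 * K * (‖a‖ ^ 2 * (‖y - x₀‖ ^ 4)⁻¹) := by ring

/-! ### The uniformly local quartic tails -/

/-- `∫_{|y−x₀| ≥ r} g |y−x₀|⁻⁴ ≤ |B₁|⁻¹ · 16 c₄ · (r−1)⁻¹ · A` for `r ≥ 2`, when the unit-ball
integrals of `g` are `≤ A` (the tree's `lintegral_compl_ball_mul_powKer_le` with the explicit
tail `∫_{|z|≥r−1}|z|⁻⁴ = c₄/(r−1)`). [folklore] -/
theorem lintegral_compl_ball_mul_powKer_le_inv {g : EuclideanSpace ℝ (Fin 3) → ℝ≥0∞}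
    (hg : AEMeasurable g volume) {A : ℝ≥0∞}
    (hA : ∀ z : EuclideanSpace ℝ (Fin 3), ∫⁻ y in ball z 1, g y ≤ A)
    (x₀ : EuclideanSpace ℝ (Fin 3)) {r : ℝ} (hr : 2 ≤ r) :
    ∫⁻ y in (ball x₀ r)ᶜ, g y * RieszKernel.powKer 4 (y - x₀) ≤
      (volume (ball (0 : EuclideanSpace ℝ (Fin 3)) 1))⁻¹ *
        (16 * ENNReal.ofReal ((∫⁻ u in (ball (0 : EuclideanSpace ℝ (Fin 3)) 1)ᶜ,
          RieszKernel.powKer 4 u).toReal)) * ENNReal.ofReal ((r - 1)⁻¹) * A := by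
  have h := lintegral_compl_ball_mul_powKer_le hg hA x₀ hr
  have hr1 : 0 < r - 1 := by linarith
  rw [Literature.Analysis.Potential.setLIntegral_compl_ball_powKer_four hr1,
    ENNReal.ofReal_mul (inv_nonneg.2 hr1.le)] at h
  refine h.trans (le_of_eq ?_)
  ring

/-! ### The far field with the cut-off -/

/-- **Seregin's (B.2.17)–(B.2.20) for the tree's far-field pressure.** There is an absolute
`K` such that for `R ≥ 1`, `ρ ≥ 2`, every centre `x₀`, every measurable slice `v(t)` whose
unit-ball energies are `≤ α` and whose `χ_R²`-weighted unit-ball energies are `≤ α_R`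
(`χ_R = 1 − cutoff R`), and every `x ∈ B(x₀, 3/2)`:
`χ_R(x) |p_far(t,x)| ≤ K (ρ⁻¹ α + (ρ/R) α + α_R^{1/2} α^{1/2})`, where
`p_far = localPressureFar x₀ 2 v t` is the far part of the expansion at radius `2`
(`∫_{|y−x₀|≥4} (K(x−y) − K(x₀−y)) : v ⊗ v dy`). Proof as printed: `|K(x−y) − K(x₀−y)| ≤
c|y−x₀|⁻⁴` on `|y−x₀| ≥ 4` (two-centre bound, `|x−x₀| < 3/2`); on the shell `4 ≤ |y−x₀| < 2ρ`
write `χ_R(x) ≤ |χ_R(x) − χ_R(y)| + χ_R(y)` with `|χ_R(x) − χ_R(y)| ≤ (C/R)|x−y| ≤ 3Cρ/R`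
(B.2.17) and bound `∫ χ_R(y)|v|²|y−x₀|⁻⁴` by Cauchy–Schwarz (B.2.18); beyond `2ρ` use `χ_R ≤ 1`
and the tail `∫_{|y−x₀|≥2ρ}|v|²|y−x₀|⁻⁴ ≤ cα/ρ` (B.2.20); all tails by the uniformly local
quartic-tail bound. [cite: Seregin2014, App. B, proof of Lemma B.6, (B.2.17)–(B.2.20), PDF p. 155] -/
theorem exists_one_sub_cutoff_mul_enorm_localPressureFar_le :
    ∃ K : ℝ≥0, ∀ (R : ℝ), 1 ≤ R → ∀ (ρ : ℝ), 2 ≤ ρ →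
      ∀ (x₀ : EuclideanSpace ℝ (Fin 3))
        (v : ℝ → EuclideanSpace ℝ (Fin 3) → EuclideanSpace ℝ (Fin 3)) (t : ℝ),
        AEStronglyMeasurable (v t) volume →
      ∀ {α αR : ℝ≥0∞},
        (∀ z : EuclideanSpace ℝ (Fin 3), ∫⁻ y in ball z 1, ‖v t y‖ₑ ^ (2 : ℕ) ≤ α) →
        (∀ z : EuclideanSpace ℝ (Fin 3),
          ∫⁻ y in ball z 1, ENNReal.ofReal ((1 - cutoff R y) ^ 2) * ‖v t y‖ₑ ^ (2 : ℕ) ≤ αR) →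
      ∀ {x : EuclideanSpace ℝ (Fin 3)}, x ∈ ball x₀ (3 / 2) →
        ENNReal.ofReal (1 - cutoff R x) * ‖localPressureFar x₀ 2 v t x‖ₑ ≤
          K * (ENNReal.ofReal ρ⁻¹ * α + ENNReal.ofReal (ρ / R) * α +
            αR ^ (1 / 2 : ℝ) * α ^ (1 / 2 : ℝ)) := by
  obtain ⟨K₀, hK₀0, hK₀⟩ := exists_abs_pressureKernel_sub_le
  obtain ⟨C₁, hC₁0, hC₁⟩ := exists_abs_one_sub_cutoff_sub_le
  -- the tail constant `V⁻¹ · 16 c₄`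
  set Vi : ℝ≥0∞ := (volume (ball (0 : EuclideanSpace ℝ (Fin 3)) 1))⁻¹ with hVi
  set c₄ : ℝ := (∫⁻ u in (ball (0 : EuclideanSpace ℝ (Fin 3)) 1)ᶜ, RieszKernel.powKer 4 u).toReal
    with hc₄
  set Tc : ℝ≥0∞ := Vi * (16 * ENNReal.ofReal c₄) with hTc
  have hVi_top : Vi ≠ ⊤ := ENNReal.inv_ne_top.2 (measure_ball_pos volume _ one_pos).ne'
  have hTc_top : Tc ≠ ⊤ := ENNReal.mul_ne_top hVi_top (ENNReal.mul_ne_top (by norm_num)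
    ENNReal.ofReal_ne_top)
  -- the constant
  set Kc : ℝ≥0∞ := ENNReal.ofReal (3 / 2 * K₀) * (4 * Tc + 3 * ENNReal.ofReal C₁ * Tc + Tc)
    with hKc
  have hKc_top : Kc ≠ ⊤ := by
    refine ENNReal.mul_ne_top ENNReal.ofReal_ne_top ?_
    refine ENNReal.add_ne_top.2 ⟨ENNReal.add_ne_top.2 ⟨ENNReal.mul_ne_top (by norm_num) hTc_top,
      ENNReal.mul_ne_top (ENNReal.mul_ne_top (by norm_num) ENNReal.ofReal_ne_top) hTc_top⟩,
      hTc_top⟩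
  refine ⟨Kc.toNNReal, ?_⟩
  intro R hR ρ hρ x₀ v t hvm α αR hα hαR x hx
  rw [ENNReal.coe_toNNReal hKc_top]
  have hRpos : 0 < R := lt_of_lt_of_le one_pos hR
  have hρpos : 0 < ρ := lt_of_lt_of_le two_pos hρ
  have hxn : ‖x - x₀‖ < 3 / 2 := by rwa [mem_ball, dist_eq_norm] at hx
  set χ : EuclideanSpace ℝ (Fin 3) → ℝ := fun y => 1 - cutoff R y with hχ
  have hχ01 : ∀ y, 0 ≤ χ y ∧ χ y ≤ 1 := fun y =>
    ⟨sub_nonneg.2 (cutoff_le_one R y), sub_le_self _ (cutoff_nonneg R y)⟩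
  -- the integrand and its pointwise bound
  set S : Set (EuclideanSpace ℝ (Fin 3)) := (ball x₀ (2 * 2))ᶜ with hS
  set F : EuclideanSpace ℝ (Fin 3) → ℝ≥0∞ := fun y =>
    ‖v t y‖ₑ ^ (2 : ℕ) * RieszKernel.powKer 4 (y - x₀) with hF
  have hFm : AEMeasurable F volume :=
    (hvm.aemeasurable.enorm.pow_const 2).mul (RieszKernel.measurable_powKer_sub 4 x₀).aemeasurable
  have hyS : ∀ y ∈ S, 4 ≤ ‖y - x₀‖ := fun y hy => by
    rw [hS, mem_compl_iff, mem_ball, dist_eq_norm, not_lt] at hy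
    linarith
  -- step 1: `‖p_far(x)‖ₑ ≤ (3K₀/2) ∫_S F`
  have h1 : ‖localPressureFar x₀ 2 v t x‖ₑ ≤ ENNReal.ofReal (3 / 2 * K₀) * ∫⁻ y in S, F y := by
    rw [localPressureFar_apply, ← lintegral_const_mul' _ _ ENNReal.ofReal_ne_top]
    refine (enorm_integral_le_lintegral_enorm _).trans ?_
    refine setLIntegral_mono' measurableSet_ball.compl fun y hy => ?_
    exact enorm_pressureKernel_sub_le_powKer hK₀0 hK₀ hxn (by linarith [hyS y hy]) (v t y)
  -- step 2: the pointwise splitting of `χ(x) F(y)` on `S`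
  set far : Set (EuclideanSpace ℝ (Fin 3)) := (ball x₀ (2 * ρ))ᶜ with hfar
  have hsplit : ∀ y ∈ S, ENNReal.ofReal (χ x) * F y ≤
      ENNReal.ofReal (3 * C₁ * (ρ / R)) * F y + ENNReal.ofReal (χ y) * F y +
        far.indicator F y := by
    intro y hy
    by_cases hyfar : y ∈ far
    · rw [indicator_of_mem hyfar]
      calc ENNReal.ofReal (χ x) * F y ≤ 1 * F y := by
            gcongr
            exact ENNReal.ofReal_le_one.2 (hχ01 x).2
        _ = F y := one_mul _
        _ ≤ _ := le_add_self
    · rw [indicator_of_notMem hyfar, add_zero, ← add_mul]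
      gcongr
      -- `χ x ≤ |χ x − χ y| + χ y ≤ 3C₁ρ/R + χ y`
      have hyρ : ‖y - x₀‖ < 2 * ρ := by
        rw [hfar, mem_compl_iff, not_not, mem_ball, dist_eq_norm] at hyfar
        exact hyfar
      have hxy : ‖x - y‖ ≤ 3 * ρ := by
        calc ‖x - y‖ = ‖(x - x₀) - (y - x₀)‖ := by rw [sub_sub_sub_cancel_right]
          _ ≤ ‖x - x₀‖ + ‖y - x₀‖ := norm_sub_le _ _
          _ ≤ 3 * ρ := by linarith
      have hdiff : |χ x - χ y| ≤ 3 * C₁ * (ρ / R) := by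
        calc |χ x - χ y| ≤ C₁ / R * ‖x - y‖ := hC₁ R hRpos x y
          _ ≤ C₁ / R * (3 * ρ) := mul_le_mul_of_nonneg_left hxy (div_nonneg hC₁0 hRpos.le)
          _ = 3 * C₁ * (ρ / R) := by ring
      have hreal : χ x ≤ 3 * C₁ * (ρ / R) + χ y := by
        have := abs_sub_le_iff.1 hdiff
        linarith [this.1]
      calc ENNReal.ofReal (χ x) ≤ ENNReal.ofReal (3 * C₁ * (ρ / R) + χ y) :=
            ENNReal.ofReal_le_ofReal hreal
        _ = ENNReal.ofReal (3 * C₁ * (ρ / R)) + ENNReal.ofReal (χ y) :=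
            ENNReal.ofReal_add (by positivity) (hχ01 y).1
  -- step 3: integrate the splitting over `S`
  have hχm : Measurable fun y => ENNReal.ofReal (χ y) :=
    ENNReal.measurable_ofReal.comp (measurable_const.sub
      (contDiff_cutoff (n := 1) R).continuous.measurable)
  have hm1 : AEMeasurable (fun y => ENNReal.ofReal (3 * C₁ * (ρ / R)) * F y) (volume.restrict S) :=
    (hFm.const_mul _).restrict
  have hm2 : AEMeasurable (fun y => ENNReal.ofReal (χ y) * F y) (volume.restrict S) :=
    (hχm.aemeasurable.mul hFm).restrict
  have hm12 : AEMeasurable (fun y => ENNReal.ofReal (3 * C₁ * (ρ / R)) * F y +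
      ENNReal.ofReal (χ y) * F y) (volume.restrict S) := hm1.add hm2
  have hind : ∫⁻ y in S, far.indicator F y ≤ ∫⁻ y in far, F y := by
    rw [lintegral_indicator measurableSet_ball.compl, Measure.restrict_restrict
      measurableSet_ball.compl]
    exact lintegral_mono_set inter_subset_left
  have h3 : ∫⁻ y in S, ENNReal.ofReal (χ x) * F y ≤
      ENNReal.ofReal (3 * C₁ * (ρ / R)) * (∫⁻ y in S, F y) + (∫⁻ y in S, ENNReal.ofReal (χ y) * F y) +
        ∫⁻ y in far, F y := by
    calc ∫⁻ y in S, ENNReal.ofReal (χ x) * F y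
        ≤ ∫⁻ y in S, (ENNReal.ofReal (3 * C₁ * (ρ / R)) * F y + ENNReal.ofReal (χ y) * F y +
            far.indicator F y) := setLIntegral_mono' measurableSet_ball.compl hsplit
      _ = ENNReal.ofReal (3 * C₁ * (ρ / R)) * (∫⁻ y in S, F y) +
            (∫⁻ y in S, ENNReal.ofReal (χ y) * F y) + ∫⁻ y in S, far.indicator F y := by
          rw [lintegral_add_left' hm12, lintegral_add_left' hm1,
            lintegral_const_mul'' _ hFm.restrict]
      _ ≤ _ := add_le_add le_rfl hind
  -- step 4: the three tails
  have hT_all : ∫⁻ y in S, F y ≤ Tc * α := by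
    have h := lintegral_compl_ball_mul_powKer_le_inv (hvm.aemeasurable.enorm.pow_const 2) hα x₀
      (show (2 : ℝ) ≤ 2 * 2 by norm_num)
    refine h.trans ?_
    rw [hTc]
    have h3 : ENNReal.ofReal ((2 * 2 - 1 : ℝ)⁻¹) ≤ 1 := ENNReal.ofReal_le_one.2 (by norm_num)
    calc Vi * (16 * ENNReal.ofReal c₄) * ENNReal.ofReal ((2 * 2 - 1 : ℝ)⁻¹) * α
        ≤ Vi * (16 * ENNReal.ofReal c₄) * 1 * α := by gcongr
      _ = Vi * (16 * ENNReal.ofReal c₄) * α := by rw [mul_one]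
  have hT_far : ∫⁻ y in far, F y ≤ Tc * ENNReal.ofReal ρ⁻¹ * α := by
    have h := lintegral_compl_ball_mul_powKer_le_inv (hvm.aemeasurable.enorm.pow_const 2) hα x₀
      (show (2 : ℝ) ≤ 2 * ρ by linarith)
    refine h.trans ?_
    rw [hTc]
    have h3 : ENNReal.ofReal ((2 * ρ - 1)⁻¹) ≤ ENNReal.ofReal ρ⁻¹ := by
      refine ENNReal.ofReal_le_ofReal ?_
      rw [inv_le_inv₀ (by linarith) hρpos]
      linarith
    exact mul_le_mul' (mul_le_mul' le_rfl h3) le_rfl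
  have hT_chisq : ∫⁻ y in S, ENNReal.ofReal (χ y ^ 2) * F y ≤ Tc * αR := by
    have hgm : AEMeasurable (fun y => ENNReal.ofReal (χ y ^ 2) * ‖v t y‖ₑ ^ (2 : ℕ)) volume :=
      (ENNReal.measurable_ofReal.comp ((measurable_const.sub
        (contDiff_cutoff (n := 1) R).continuous.measurable).pow_const 2)).aemeasurable.mul
        (hvm.aemeasurable.enorm.pow_const 2)
    have h := lintegral_compl_ball_mul_powKer_le_inv hgm hαR x₀ (show (2 : ℝ) ≤ 2 * 2 by norm_num)
    have e : ∫⁻ y in S, ENNReal.ofReal (χ y ^ 2) * F y =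
        ∫⁻ y in (ball x₀ (2 * 2))ᶜ, ENNReal.ofReal (χ y ^ 2) * ‖v t y‖ₑ ^ (2 : ℕ) *
          RieszKernel.powKer 4 (y - x₀) := by
      simp only [hF, hS, mul_assoc]
    rw [e]
    refine h.trans ?_
    have h3 : ENNReal.ofReal ((2 * 2 - 1 : ℝ)⁻¹) ≤ 1 := ENNReal.ofReal_le_one.2 (by norm_num)
    calc Vi * (16 * ENNReal.ofReal c₄) * ENNReal.ofReal ((2 * 2 - 1 : ℝ)⁻¹) * αR
        ≤ Vi * (16 * ENNReal.ofReal c₄) * 1 * αR := by gcongr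
      _ = Tc * αR := by rw [mul_one]
  -- Cauchy–Schwarz for the `χ(y)` term
  have hT_chi : ∫⁻ y in S, ENNReal.ofReal (χ y) * F y ≤
      (Tc * αR) ^ (1 / 2 : ℝ) * (Tc * α) ^ (1 / 2 : ℝ) := by
    -- write the integrand as a product `f g` with `f² = χ² F`, `g² = F`
    set P : EuclideanSpace ℝ (Fin 3) → ℝ≥0∞ := fun y => RieszKernel.powKer 2 (y - x₀) with hP
    have hPm : Measurable P := RieszKernel.measurable_powKer_sub 2 x₀
    have hPP : ∀ y, P y * P y = RieszKernel.powKer 4 (y - x₀) := by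
      intro y
      by_cases hy : y - x₀ = 0
      · simp only [hP, hy, RieszKernel.powKer_apply, norm_zero]
        rw [Real.zero_rpow (by norm_num), Real.zero_rpow (by norm_num), ENNReal.ofReal_zero,
          mul_zero]
      · rw [hP, RieszKernel.powKer_mul_powKer hy]; norm_num
    set f : EuclideanSpace ℝ (Fin 3) → ℝ≥0∞ := fun y => ENNReal.ofReal (χ y) * ‖v t y‖ₑ * P y
      with hf
    set g : EuclideanSpace ℝ (Fin 3) → ℝ≥0∞ := fun y => ‖v t y‖ₑ * P y with hg
    have hfm : AEMeasurable f (volume.restrict S) :=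
      ((hχm.aemeasurable.mul hvm.aemeasurable.enorm).mul hPm.aemeasurable).restrict
    have hgm' : AEMeasurable g (volume.restrict S) :=
      (hvm.aemeasurable.enorm.mul hPm.aemeasurable).restrict
    have hfg : ∀ y, ENNReal.ofReal (χ y) * F y = f y * g y := by
      intro y
      simp only [hf, hg, hF]
      rw [← hPP y]
      ring
    have hff : ∀ y, f y ^ (2 : ℝ) = ENNReal.ofReal (χ y ^ 2) * F y := by
      intro y
      simp only [hf, hF]
      rw [show (2 : ℝ) = ((2 : ℕ) : ℝ) by norm_num, ENNReal.rpow_natCast, ← hPP y,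
        ENNReal.ofReal_pow (hχ01 y).1]
      ring
    have hgg : ∀ y, g y ^ (2 : ℝ) = F y := by
      intro y
      simp only [hg, hF]
      rw [show (2 : ℝ) = ((2 : ℕ) : ℝ) by norm_num, ENNReal.rpow_natCast, ← hPP y]
      ring
    have hpq : (2 : ℝ).HolderConjugate 2 := by
      have := Real.holderConjugate_one_div (a := 1 / 2) (b := 1 / 2) (by norm_num) (by norm_num)
        (by norm_num)
      norm_num at this
      exact this
    have hH := ENNReal.lintegral_mul_le_Lp_mul_Lq (volume.restrict S) hpq hfm hgm'
    calc ∫⁻ y in S, ENNReal.ofReal (χ y) * F y = ∫⁻ y in S, (f * g) y :=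
          lintegral_congr fun y => hfg y
      _ ≤ (∫⁻ y in S, f y ^ (2 : ℝ)) ^ (1 / (2 : ℝ)) * (∫⁻ y in S, g y ^ (2 : ℝ)) ^ (1 / (2 : ℝ)) := hH
      _ = (∫⁻ y in S, ENNReal.ofReal (χ y ^ 2) * F y) ^ (1 / 2 : ℝ) *
            (∫⁻ y in S, F y) ^ (1 / 2 : ℝ) := by
          rw [lintegral_congr fun y => hff y, lintegral_congr fun y => hgg y]
      _ ≤ (Tc * αR) ^ (1 / 2 : ℝ) * (Tc * α) ^ (1 / 2 : ℝ) := by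
          gcongr
  -- assemble
  have hTc_half : (Tc * αR) ^ (1 / 2 : ℝ) * (Tc * α) ^ (1 / 2 : ℝ) =
      Tc * (αR ^ (1 / 2 : ℝ) * α ^ (1 / 2 : ℝ)) := by
    rw [ENNReal.mul_rpow_of_nonneg Tc αR (by norm_num : (0 : ℝ) ≤ 1 / 2),
      ENNReal.mul_rpow_of_nonneg Tc α (by norm_num : (0 : ℝ) ≤ 1 / 2)]
    have : Tc ^ (1 / 2 : ℝ) * Tc ^ (1 / 2 : ℝ) = Tc := by
      rw [← ENNReal.rpow_add_of_nonneg _ _ (by norm_num) (by norm_num)]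
      norm_num
    calc Tc ^ (1 / 2 : ℝ) * αR ^ (1 / 2 : ℝ) * (Tc ^ (1 / 2 : ℝ) * α ^ (1 / 2 : ℝ))
        = (Tc ^ (1 / 2 : ℝ) * Tc ^ (1 / 2 : ℝ)) * (αR ^ (1 / 2 : ℝ) * α ^ (1 / 2 : ℝ)) := by ring
      _ = _ := by rw [this]
  calc ENNReal.ofReal (χ x) * ‖localPressureFar x₀ 2 v t x‖ₑ
      ≤ ENNReal.ofReal (χ x) * (ENNReal.ofReal (3 / 2 * K₀) * ∫⁻ y in S, F y) := by gcongr
    _ = ENNReal.ofReal (3 / 2 * K₀) * (ENNReal.ofReal (χ x) * ∫⁻ y in S, F y) := by ring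
    _ ≤ ENNReal.ofReal (3 / 2 * K₀) * ∫⁻ y in S, ENNReal.ofReal (χ x) * F y := by
        gcongr
        exact lintegral_const_mul_le _ _
    _ ≤ ENNReal.ofReal (3 / 2 * K₀) * (ENNReal.ofReal (3 * C₁ * (ρ / R)) * (∫⁻ y in S, F y) +
          (∫⁻ y in S, ENNReal.ofReal (χ y) * F y) + ∫⁻ y in far, F y) := by gcongr
    _ ≤ ENNReal.ofReal (3 / 2 * K₀) * (ENNReal.ofReal (3 * C₁ * (ρ / R)) * (Tc * α) +
          Tc * (αR ^ (1 / 2 : ℝ) * α ^ (1 / 2 : ℝ)) + Tc * ENNReal.ofReal ρ⁻¹ * α) := by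
        rw [← hTc_half]
        exact mul_le_mul' le_rfl (add_le_add (add_le_add (mul_le_mul' le_rfl hT_all) hT_chi) hT_far)
    _ ≤ Kc * (ENNReal.ofReal ρ⁻¹ * α + ENNReal.ofReal (ρ / R) * α +
          αR ^ (1 / 2 : ℝ) * α ^ (1 / 2 : ℝ)) := by
        rw [hKc]
        have e3 : ENNReal.ofReal (3 * C₁ * (ρ / R)) = 3 * ENNReal.ofReal C₁ * ENNReal.ofReal (ρ / R) := by
          rw [ENNReal.ofReal_mul (by positivity), ENNReal.ofReal_mul (by norm_num),
            ENNReal.ofReal_ofNat]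
        rw [e3]
        -- `3B(ρ/R)·(Tc α) + Tc X₃ + Tc ρ⁻¹ α ≤ (4Tc + 3B Tc + Tc)(X₁ + X₂ + X₃)` termwise
        have i₂ : ENNReal.ofReal (ρ / R) * α ≤ ENNReal.ofReal ρ⁻¹ * α + ENNReal.ofReal (ρ / R) * α +
            αR ^ (1 / 2 : ℝ) * α ^ (1 / 2 : ℝ) := le_add_right le_add_self
        have i₃ : αR ^ (1 / 2 : ℝ) * α ^ (1 / 2 : ℝ) ≤ ENNReal.ofReal ρ⁻¹ * α +
            ENNReal.ofReal (ρ / R) * α + αR ^ (1 / 2 : ℝ) * α ^ (1 / 2 : ℝ) := le_add_self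
        have i₁ : ENNReal.ofReal ρ⁻¹ * α ≤ ENNReal.ofReal ρ⁻¹ * α + ENNReal.ofReal (ρ / R) * α +
            αR ^ (1 / 2 : ℝ) * α ^ (1 / 2 : ℝ) := le_add_right (le_add_right le_rfl)
        have i₄ : ENNReal.ofReal ρ⁻¹ * α ≤ 4 * (ENNReal.ofReal ρ⁻¹ * α + ENNReal.ofReal (ρ / R) * α +
            αR ^ (1 / 2 : ℝ) * α ^ (1 / 2 : ℝ)) :=
          i₁.trans (le_mul_of_one_le_left (by simp) (by norm_num))
        have step : 3 * ENNReal.ofReal C₁ * ENNReal.ofReal (ρ / R) * (Tc * α) +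
            Tc * (αR ^ (1 / 2 : ℝ) * α ^ (1 / 2 : ℝ)) + Tc * ENNReal.ofReal ρ⁻¹ * α ≤
            (4 * Tc + 3 * ENNReal.ofReal C₁ * Tc + Tc) * (ENNReal.ofReal ρ⁻¹ * α +
              ENNReal.ofReal (ρ / R) * α + αR ^ (1 / 2 : ℝ) * α ^ (1 / 2 : ℝ)) := by
          have e1 : 3 * ENNReal.ofReal C₁ * ENNReal.ofReal (ρ / R) * (Tc * α) =
              3 * ENNReal.ofReal C₁ * Tc * (ENNReal.ofReal (ρ / R) * α) := by ring
          have e2 : Tc * ENNReal.ofReal ρ⁻¹ * α = Tc * (ENNReal.ofReal ρ⁻¹ * α) := by ring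
          have e3 : (4 * Tc + 3 * ENNReal.ofReal C₁ * Tc + Tc) * (ENNReal.ofReal ρ⁻¹ * α +
              ENNReal.ofReal (ρ / R) * α + αR ^ (1 / 2 : ℝ) * α ^ (1 / 2 : ℝ)) =
              3 * ENNReal.ofReal C₁ * Tc * (ENNReal.ofReal ρ⁻¹ * α +
                ENNReal.ofReal (ρ / R) * α + αR ^ (1 / 2 : ℝ) * α ^ (1 / 2 : ℝ)) +
              Tc * (ENNReal.ofReal ρ⁻¹ * α + ENNReal.ofReal (ρ / R) * α +
                αR ^ (1 / 2 : ℝ) * α ^ (1 / 2 : ℝ)) +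
              Tc * (4 * (ENNReal.ofReal ρ⁻¹ * α + ENNReal.ofReal (ρ / R) * α +
                αR ^ (1 / 2 : ℝ) * α ^ (1 / 2 : ℝ))) := by ring
          rw [e1, e2, e3]
          exact add_le_add (add_le_add (mul_le_mul' le_rfl i₂) (mul_le_mul' le_rfl i₃))
            (mul_le_mul' le_rfl i₄)
        calc ENNReal.ofReal (3 / 2 * K₀) * (3 * ENNReal.ofReal C₁ * ENNReal.ofReal (ρ / R) * (Tc * α) +
              Tc * (αR ^ (1 / 2 : ℝ) * α ^ (1 / 2 : ℝ)) + Tc * ENNReal.ofReal ρ⁻¹ * α) ≤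
            ENNReal.ofReal (3 / 2 * K₀) * ((4 * Tc + 3 * ENNReal.ofReal C₁ * Tc + Tc) *
              (ENNReal.ofReal ρ⁻¹ * α + ENNReal.ofReal (ρ / R) * α +
                αR ^ (1 / 2 : ℝ) * α ^ (1 / 2 : ℝ))) := mul_le_mul' le_rfl step
          _ = ENNReal.ofReal (3 / 2 * K₀) * (4 * Tc + 3 * ENNReal.ofReal C₁ * Tc + Tc) *
              (ENNReal.ofReal ρ⁻¹ * α + ENNReal.ofReal (ρ / R) * α +
                αR ^ (1 / 2 : ℝ) * α ^ (1 / 2 : ℝ)) := by ring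

end Literature.Analysis.FluidPDE

end
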